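import Mathlib.MeasureTheory.Constructions.Cylinders
import Mathlib.MeasureTheory.Integral.Bochner.Basic
import Mathlib.MeasureTheory.Integral.Bochner.Set
import Mathlib.MeasureTheory.Measure.Typeclasses.Probability
import Mathlib.MeasureTheory.Measure.Real
import HarnessLib

/-!
# A DLR-uniqueness criterion: boundary-uniform kernels and tight one-site marginals

Topic `Literature/Probability/LatticeModels`; theorems only (no definitions, no named facts).

The abstract last step of the classical proof of uniqueness of the Gibbs state of
one-dimensional models governed by a strictly positive compact transfer operator (Georgii 2011,
Thm 10.25 and §11.1; for unbounded spins Cassandro–Olivieri–Pellegrinotti–Presutti 1978, §2):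
once the finite-volume kernels `γ_Λ(A | η)` of a cylinder event `A` are known to converge to a
number `L(A)` UNIFORMLY over all boundary conditions whose (boundedly many) boundary spins lie in a
prescribed compact set, every DLR state whose one-site marginals are uniformly tight gives `A` the
mass `L(A)`; two such states therefore agree on a generating π-system and coincide.

* `abs_measureReal_sub_le_of_dlr` — the one-volume estimate
  `|μ(A) - L| ≤ ε + (1 + |L|) · |B| · δ` when `|γ_Λ(A|η) - L| ≤ ε` for all `η` whose spins at
  the sites of `B` lie in a measurable `C` with `μ(η_x ∉ C) ≤ δ` for every site `x`;
* `measureReal_eq_of_dlr_of_boundaryUniform` — hence `μ(A) = L` under boundary-uniform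
  convergence on compacts and uniform tightness of the one-site marginals;
* `measure_eq_of_dlr_of_boundaryUniform` — **uniqueness**: two such DLR states coincide when the
  boundary-uniform limits exist on a π-system generating the product σ-algebra.

The specification is a bare function `γ : Finset V → (V → S) → Measure (V → S)` (no consistency or
properness is used), the DLR equation is the junk-free `∫⁻ η, γ Λ η A ∂μ = μ A` of
`Literature.Probability.LatticeModels.IsGibbsMeasure`, and tightness is asked for the family of
one-site marginals (for a translation-invariant state on `ℤ` it is tightness of ONE finite measure).
[cite: Georgii2011, Thm 10.25 and §11.1]
-/

noncomputable section

open MeasureTheory Set Filter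
open scoped ENNReal

namespace Literature.Probability.LatticeModels

variable {V S : Type*} [MeasurableSpace S]

/-- **The one-volume estimate.** Let `μ` be a probability measure on `V → S` satisfying the DLR
equation `∫⁻ γ_Λ(A|η) dμ = μ(A)` for the volume `Λ` and the set `A`, with `η ↦ γ_Λ(A|η)` measurable
and `≤ 1`. If `|γ_Λ(A|η) - L| ≤ ε` (`ε ≥ 0`) for every `η` whose spins at the sites of `B` lie in the
measurable set `C`, and `μ(η_x ∉ C) ≤ δ` (`δ ≥ 0`) for every site `x`, then
`|μ(A) - L| ≤ ε + (1 + |L|) · |B| · δ`. [cite: Georgii2011, Thm 10.25 and §11.1] -/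
theorem abs_measureReal_sub_le_of_dlr (γ : Finset V → (V → S) → Measure (V → S))
    (μ : Measure (V → S)) [IsProbabilityMeasure μ] {A : Set (V → S)} {Λ B : Finset V}
    (hγ1 : ∀ η, γ Λ η A ≤ 1) (hγm : Measurable fun η => γ Λ η A)
    (hDLR : ∫⁻ η, γ Λ η A ∂μ = μ A) {C : Set S} (hC : MeasurableSet C) {L ε δ : ℝ} (hε : 0 ≤ ε)
    (hδ : 0 ≤ δ) (hH : ∀ η : V → S, (∀ b ∈ B, η b ∈ C) → |(γ Λ η A).toReal - L| ≤ ε)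
    (hT : ∀ x : V, μ {η | η x ∉ C} ≤ ENNReal.ofReal δ) :
    |μ.real A - L| ≤ ε + (1 + |L|) * (B.card * δ) := by
  classical
  -- the kernel as a real function
  set g : (V → S) → ℝ := fun η => (γ Λ η A).toReal with hg
  have hgm : Measurable g := hγm.ennreal_toReal
  have hg0 : ∀ η, 0 ≤ g η := fun η => ENNReal.toReal_nonneg
  have hg1 : ∀ η, g η ≤ 1 := fun η => by
    have h := ENNReal.toReal_mono ENNReal.one_ne_top (hγ1 η)
    simpa [hg] using h
  have hgi : Integrable g μ :=
    Integrable.of_bound hgm.aestronglyMeasurable 1 (Eventually.of_forall fun η => by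
      rw [Real.norm_eq_abs, abs_of_nonneg (hg0 η)]; exact hg1 η)
  -- `μ(A) = ∫ g dμ`
  have hμA : μ.real A = ∫ η, g η ∂μ := by
    have h1 : ∫⁻ η, γ Λ η A ∂μ = ∫⁻ η, ENNReal.ofReal (g η) ∂μ := by
      refine lintegral_congr fun η => ?_
      rw [hg, ENNReal.ofReal_toReal (ne_top_of_le_ne_top ENNReal.one_ne_top (hγ1 η))]
    have h2 : ∫⁻ η, ENNReal.ofReal (g η) ∂μ = ENNReal.ofReal (∫ η, g η ∂μ) :=
      (ofReal_integral_eq_lintegral_ofReal hgi (Eventually.of_forall hg0)).symm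
    rw [Measure.real, ← hDLR, h1, h2, ENNReal.toReal_ofReal (integral_nonneg hg0)]
  -- the bad set
  set G : Set (V → S) := {η | ∀ b ∈ B, η b ∈ C} with hG
  have hGc : Gᶜ = ⋃ b ∈ B, {η : V → S | η b ∉ C} := by
    ext η
    simp [hG]
  have hGm : MeasurableSet G := by
    have : G = ⋂ b ∈ B, (fun η : V → S => η b) ⁻¹' C := by
      ext η; simp [hG]
    rw [this]
    exact MeasurableSet.biInter B.countable_toSet fun b _ => measurable_pi_apply b hC
  have hμGc : μ.real Gᶜ ≤ B.card * δ := by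
    have h1 : μ Gᶜ ≤ ENNReal.ofReal (B.card * δ) := by
      rw [hGc]
      calc μ (⋃ b ∈ B, {η : V → S | η b ∉ C}) ≤ ∑ b ∈ B, μ {η : V → S | η b ∉ C} :=
            measure_biUnion_finset_le B _
        _ ≤ ∑ _b ∈ B, ENNReal.ofReal δ := Finset.sum_le_sum fun b _ => hT b
        _ = ENNReal.ofReal (B.card * δ) := by
            rw [Finset.sum_const, nsmul_eq_mul, ENNReal.ofReal_mul (Nat.cast_nonneg _),
              ENNReal.ofReal_natCast]
    exact ENNReal.toReal_le_of_le_ofReal (by positivity) h1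
  -- pointwise bound `|g - L| ≤ ε + (1 + |L|) 𝟙_{Gᶜ}`
  have hpt : ∀ η, |g η - L| ≤ ε + (1 + |L|) * Gᶜ.indicator (1 : (V → S) → ℝ) η := by
    intro η
    by_cases hη : η ∈ G
    · have : Gᶜ.indicator (1 : (V → S) → ℝ) η = 0 := indicator_of_notMem (by simpa using hη) _
      rw [this, mul_zero, add_zero]
      exact hH η hη
    · have : Gᶜ.indicator (1 : (V → S) → ℝ) η = 1 := indicator_of_mem (by simpa using hη) _
      rw [this, mul_one]
      calc |g η - L| ≤ |g η| + |L| := abs_sub _ _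
        _ ≤ 1 + |L| := by rw [abs_of_nonneg (hg0 η)]; linarith [hg1 η]
        _ ≤ ε + (1 + |L|) := le_add_of_nonneg_left hε
  -- integrate
  have hind_i : Integrable (fun η => Gᶜ.indicator (1 : (V → S) → ℝ) η) μ :=
    (integrable_const (1 : ℝ)).indicator hGm.compl
  have hrhs_i : Integrable (fun η => ε + (1 + |L|) * Gᶜ.indicator (1 : (V → S) → ℝ) η) μ :=
    (integrable_const ε).add (hind_i.const_mul _)
  have hsub : μ.real A - L = ∫ η, (g η - L) ∂μ := by
    rw [integral_sub hgi (integrable_const L), integral_const, smul_eq_mul, probReal_univ, one_mul,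
      hμA]
  calc |μ.real A - L| = |∫ η, (g η - L) ∂μ| := by rw [hsub]
    _ ≤ ∫ η, |g η - L| ∂μ := abs_integral_le_integral_abs
    _ ≤ ∫ η, (ε + (1 + |L|) * Gᶜ.indicator (1 : (V → S) → ℝ) η) ∂μ :=
        integral_mono (hgi.sub (integrable_const L)).abs hrhs_i hpt
    _ = ε + (1 + |L|) * μ.real Gᶜ := by
        rw [integral_add (integrable_const ε) (hind_i.const_mul _), integral_const, smul_eq_mul,
          probReal_univ, one_mul, integral_const_mul, integral_indicator_one hGm.compl]
    _ ≤ ε + (1 + |L|) * (B.card * δ) := by gcongr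

variable [TopologicalSpace S] [OpensMeasurableSpace S] [T2Space S]

/-- **DLR states with tight one-site marginals give a cylinder event its boundary-uniform limit.**
Let `μ` be a probability measure on `V → S` satisfying the DLR equations for the measurable set `A`
with kernels `γ_Λ(A | ·)` that are measurable and `≤ 1`, whose one-site marginals are uniformly
tight (`∀ δ > 0 ∃ C` compact with `μ(η_x ∉ C) ≤ δ` for all `x`). If for every compact `C` and every
`ε > 0` some volume `Λ` and at most `nb` boundary sites `B` satisfy `|γ_Λ(A|η) - L| ≤ ε` whenever
`η(B) ⊆ C`, then `μ(A) = L`. [cite: Georgii2011, Thm 10.25 and §11.1] -/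
theorem measureReal_eq_of_dlr_of_boundaryUniform (γ : Finset V → (V → S) → Measure (V → S))
    (μ : Measure (V → S)) [IsProbabilityMeasure μ] {A : Set (V → S)}
    (hγ1 : ∀ Λ η, γ Λ η A ≤ 1) (hγm : ∀ Λ, Measurable fun η => γ Λ η A)
    (hDLR : ∀ Λ, ∫⁻ η, γ Λ η A ∂μ = μ A)
    (hT : ∀ δ : ℝ, 0 < δ → ∃ C : Set S, IsCompact C ∧ ∀ x : V, μ {η | η x ∉ C} ≤ ENNReal.ofReal δ)
    {L : ℝ} {nb : ℕ}
    (hH : ∀ C : Set S, IsCompact C → ∀ ε : ℝ, 0 < ε → ∃ (Λ : Finset V) (B : Finset V),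
      B.card ≤ nb ∧ ∀ η : V → S, (∀ b ∈ B, η b ∈ C) → |(γ Λ η A).toReal - L| ≤ ε) :
    μ.real A = L := by
  -- `|μ(A) - L| ≤ ε (1 + (1 + |L|) nb)` for every `ε > 0`
  have key : ∀ ε : ℝ, 0 < ε → |μ.real A - L| ≤ ε * (1 + (1 + |L|) * nb) := by
    intro ε hε
    obtain ⟨C, hCc, hCμ⟩ := hT ε hε
    obtain ⟨Λ, B, hB, hHB⟩ := hH C hCc ε hε
    have h := abs_measureReal_sub_le_of_dlr γ μ (hγ1 Λ) (hγm Λ) (hDLR Λ) hCc.measurableSet hε.le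
      hε.le hHB hCμ
    calc |μ.real A - L| ≤ ε + (1 + |L|) * (B.card * ε) := h
      _ ≤ ε + (1 + |L|) * (nb * ε) := by gcongr
      _ = ε * (1 + (1 + |L|) * nb) := by ring
  -- hence `μ(A) = L`
  have h0 : |μ.real A - L| ≤ 0 := by
    refine le_of_forall_pos_le_add fun ε hε => ?_
    have hK : 0 < 1 + (1 + |L|) * nb := by positivity
    have h := key (ε / (1 + (1 + |L|) * nb)) (div_pos hε hK)
    rw [div_mul_cancel₀ _ hK.ne'] at h
    linarith
  exact eq_of_abs_sub_nonpos h0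

/-- **Uniqueness of the DLR state from boundary-uniform convergence of the kernels.** Let `𝒜` be a
π-system of measurable sets generating the product σ-algebra of `V → S` and `γ` a family of kernels
that are probability measures, measurable in the boundary condition on `𝒜`, such that every
`A ∈ 𝒜` has a boundary-uniform limit: a number `L` with, for every compact `C` and `ε > 0`, a
volume `Λ` and `≤ nb` boundary sites `B` with `|γ_Λ(A|η) - L| ≤ ε` whenever `η(B) ⊆ C`. Then any
two probability measures satisfying the DLR equations on `𝒜` and having uniformly tight one-site
marginals are EQUAL (Georgii 2011, Thm 10.25 / §11.1: the Gibbs state of a one-dimensional model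
with a strictly positive compact transfer operator is unique among tempered / shift-invariant
states; Cassandro–Olivieri–Pellegrinotti–Presutti 1978 for unbounded spins).
[cite: Georgii2011, Thm 10.25 and §11.1] -/
theorem measure_eq_of_dlr_of_boundaryUniform (γ : Finset V → (V → S) → Measure (V → S))
    {𝒜 : Set (Set (V → S))} (h𝒜 : MeasurableSpace.pi = MeasurableSpace.generateFrom 𝒜)
    (h𝒜pi : IsPiSystem 𝒜) (hγp : ∀ Λ η, IsProbabilityMeasure (γ Λ η))
    (hγm : ∀ A ∈ 𝒜, ∀ Λ, Measurable fun η => γ Λ η A) (nb : ℕ)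
    (hH : ∀ A ∈ 𝒜, ∃ L : ℝ, ∀ C : Set S, IsCompact C → ∀ ε : ℝ, 0 < ε →
      ∃ (Λ : Finset V) (B : Finset V), B.card ≤ nb ∧
        ∀ η : V → S, (∀ b ∈ B, η b ∈ C) → |(γ Λ η A).toReal - L| ≤ ε)
    (μ₁ μ₂ : Measure (V → S)) [IsProbabilityMeasure μ₁] [IsProbabilityMeasure μ₂]
    (hDLR₁ : ∀ Λ, ∀ A ∈ 𝒜, ∫⁻ η, γ Λ η A ∂μ₁ = μ₁ A)
    (hDLR₂ : ∀ Λ, ∀ A ∈ 𝒜, ∫⁻ η, γ Λ η A ∂μ₂ = μ₂ A)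
    (hT₁ : ∀ δ : ℝ, 0 < δ → ∃ C : Set S, IsCompact C ∧ ∀ x : V, μ₁ {η | η x ∉ C} ≤ ENNReal.ofReal δ)
    (hT₂ : ∀ δ : ℝ, 0 < δ → ∃ C : Set S, IsCompact C ∧ ∀ x : V, μ₂ {η | η x ∉ C} ≤ ENNReal.ofReal δ) :
    μ₁ = μ₂ := by
  refine ext_of_generate_finite 𝒜 h𝒜 h𝒜pi (fun A hA => ?_) (by simp)
  obtain ⟨L, hL⟩ := hH A hA
  have h1 : μ₁.real A = L :=
    measureReal_eq_of_dlr_of_boundaryUniform γ μ₁ (fun Λ η => prob_le_one) (hγm A hA)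
      (fun Λ => hDLR₁ Λ A hA) hT₁ hL
  have h2 : μ₂.real A = L :=
    measureReal_eq_of_dlr_of_boundaryUniform γ μ₂ (fun Λ η => prob_le_one) (hγm A hA)
      (fun Λ => hDLR₂ Λ A hA) hT₂ hL
  have h : μ₁.real A = μ₂.real A := h1.trans h2.symm
  exact (ENNReal.toReal_eq_toReal_iff' (measure_ne_top μ₁ A) (measure_ne_top μ₂ A)).1 h

end Literature.Probability.LatticeModels

end
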